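import Summits.Langlands.Langlands.Theorems.ParityBlindBianchiResidualBianchiDoorMod2TwoAdicModel
import Literature.NumberTheory.Automorphic.ChebotarevArtinRepHolds
import Literature.NumberTheory.Automorphic.ReciprocityGLn
import Literature.NumberTheory.Automorphic.AutomorphicRepsGL
import Literature.NumberTheory.Automorphic.TunnellOctahedralLocal
import Literature.NumberTheory.GaloisRepresentations.HeckeCharacterProofs
import HarnessLib

/-!
# Stub stub_cuspWitness of line Sketch
# (crux stmt-Langlands-15112 `ParityBlindBianchi.ResidualBianchiDoorLevel`)

A uniform-in-`K` non-twist witness at an inert good place.  Let `σ₀ : Γ_ℚ → GL₂(ℚ̄₂)` have finite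
image and projective image `≅ A₅`, `S` a finite set of primes, `π` a cuspidal datum on `GL₂(𝔸_ℚ)`
congruent (coefficientwise in `𝔪_{ℤ̄₂}`) to `σ₀` at every place over no prime of `S`, and `K` a
quadratic field.  Then some place `v` of `ℚ` over no prime of `S` is inert in `K` (a place `w ∣ v`
of residue degree `2 = [K:ℚ]`) and `π` has at `v` a Satake parameter `α` with `ζ • α ≠ α` for the
primitive square root of unity `ζ = -1`.

Proof.  (1) `Γ_K ≤ Γ_ℚ` has index `2` and still surjects onto the simple projective image `≅ A₅`
(`projectiveImage_comp_eq_of_index_two`), so an element of `A₅` of order `3` lifts to some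
`g₀ ∉ Γ_K`.  (2) `M = σ₀(g₀)`: `M³` is scalar and `M` is not, so Cayley–Hamilton forces
`tr(M)² = det M`, a root of unity (finite image): `‖tr M‖ = 1`.  (3) Chebotarev for the Artin
representation `GL₂(ι) ∘ σ₀` together with the quadratic sign of `K`
(`infinite_setOf_frob_eq_and_quadraticSign_eq_neg_one`, `chebotarev_artinRep_holds`) gives
infinitely many places `v`, inert in `K`, with `σ₀(Frob_v) = σ₀(g₀)`; only finitely many lie over a
prime of `S`.
(4) At such a good `v` the congruence at the `X`-coefficient reads `‖-(a+b) - c₁‖ < 1` with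
`a + b = tr M` of norm `1` and `c₁` the `X`-coefficient of the predicted polynomial, whose roots are
the `ι⁻¹((√q x)⁻¹)`, `x ∈ α`; if `-α = α` then `c₁ = -c₁ = 0`, contradiction.
-/

noncomputable section

namespace Summit.Langlands.Langlands.Cruxes.ResidualBianchiDoorLevel.Sketch

set_option linter.dupNamespace false

open scoped MatrixGroups Polynomial Valued Classical
open Polynomial NumberField IsDedekindDomain Filter
open Literature.NumberTheory.Automorphic Literature.NumberTheory.GaloisRepresentations

/-! ### Group theory: an element of order `3` in `A₅` -/

/-- `A₅` has a non-trivial element of order dividing `3` (a `3`-cycle). [folklore] -/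
theorem exists_alternatingGroup_fin_five_ne_one_and_pow_three_eq_one :
    ∃ x : alternatingGroup (Fin 5), x ≠ 1 ∧ x ^ 3 = 1 := by
  decide

/-! ### Linear algebra: `M³` scalar, `M` non-scalar -/

/-- **Cayley–Hamilton for a `2 × 2` matrix of projective order `3`.**  If `M³` is scalar and `M`
is not, then `tr(M)² = det M`: by Cayley–Hamilton `M³ = (tr² - det) M - (tr · det) 1`, so
`tr² - det ≠ 0` would make `M` scalar. [folklore] -/
theorem trace_sq_eq_det_of_pow_three_mem_range_scalar {F : Type*} [Field F]
    {M : Matrix (Fin 2) (Fin 2) F} (h3 : M ^ 3 ∈ Set.range (Matrix.scalar (Fin 2)))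
    (h1 : M ∉ Set.range (Matrix.scalar (Fin 2))) : M.trace ^ 2 = M.det := by
  by_contra hne
  have hne' : M.trace ^ 2 - M.det ≠ 0 := sub_ne_zero.mpr hne
  obtain ⟨c, hc⟩ := h3
  apply h1
  have hCH : M ^ 3 =
      (M.trace ^ 2 - M.det) • M - (M.trace * M.det) • (1 : Matrix (Fin 2) (Fin 2) F) := by
    ext i j
    fin_cases i <;> fin_cases j <;>
      simp [pow_succ, Matrix.mul_apply, Fin.sum_univ_two, Matrix.trace_fin_two,
        Matrix.det_fin_two] <;> ring
  have hc' : c • (1 : Matrix (Fin 2) (Fin 2) F) = M ^ 3 := by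
    rw [← hc, Matrix.scalar_apply, Matrix.smul_one_eq_diagonal]
  have key : (M.trace ^ 2 - M.det) • M =
      (c + M.trace * M.det) • (1 : Matrix (Fin 2) (Fin 2) F) := by
    rw [add_smul, hc', hCH, sub_add_cancel]
  refine ⟨(M.trace ^ 2 - M.det)⁻¹ * (c + M.trace * M.det), ?_⟩
  rw [Matrix.scalar_apply, ← Matrix.smul_one_eq_diagonal, mul_smul, ← key, smul_smul,
    inv_mul_cancel₀ hne', one_smul]

/-- If moreover `M` has finite order, then `det M` is a root of unity, so `‖tr M‖² = ‖det M‖ = 1`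
and `‖tr M‖ = 1`. [folklore] -/
theorem norm_trace_eq_one_of_pow_three {F : Type*} [NormedField F]
    {M : Matrix (Fin 2) (Fin 2) F} (h3 : M ^ 3 ∈ Set.range (Matrix.scalar (Fin 2)))
    (h1 : M ∉ Set.range (Matrix.scalar (Fin 2))) {N : ℕ} (hN : 0 < N) (hMN : M ^ N = 1) :
    ‖M.trace‖ = 1 := by
  have hdet : ‖M.det‖ = 1 := by
    have h : ‖M.det‖ ^ N = 1 := by
      rw [← norm_pow, ← Matrix.det_pow, hMN, Matrix.det_one, norm_one]
    exact (pow_eq_one_iff_of_nonneg (norm_nonneg _) hN.ne').mp h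
  have h2 : ‖M.trace‖ ^ 2 = 1 := by
    rw [← norm_pow, trace_sq_eq_det_of_pow_three_mem_range_scalar h3 h1, hdet]
  exact (pow_eq_one_iff_of_nonneg (norm_nonneg _) two_ne_zero).mp h2

/-- `GL_n` of a ring isomorphism is injective (`GL_n(e⁻¹)` is a left inverse). [folklore] -/
theorem generalLinearGroup_map_ringEquiv_injective {R S : Type*} [CommRing R] [CommRing S]
    {m : Type*} [Fintype m] [DecidableEq m] (e : R ≃+* S) :
    Function.Injective (Matrix.GeneralLinearGroup.map (n := m) e.toRingHom) := by
  intro x y hxy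
  have h := congrArg (Matrix.GeneralLinearGroup.map (n := m) e.symm.toRingHom) hxy
  rwa [← Matrix.GeneralLinearGroup.map_comp_apply, ← Matrix.GeneralLinearGroup.map_comp_apply,
    ← Matrix.GeneralLinearGroup.map_comp, RingEquiv.symm_toRingHom_comp_toRingHom,
    Matrix.GeneralLinearGroup.map_id, MonoidHom.id_apply, MonoidHom.id_apply] at h

/-! ### Polynomials: the `X`-coefficient -/

/-- `(X - a)(X - b)` has `X`-coefficient `-(a + b)`. [folklore] -/
theorem coeff_one_X_sub_C_mul {R : Type*} [CommRing R] (a b : R) :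
    ((X - C a) * (X - C b)).coeff 1 = -(a + b) := by
  have h : (X - C a) * (X - C b) = X ^ 2 - C (a + b) * X + C (a * b) := by
    simp only [map_add, map_mul]; ring
  rw [h]
  simp [coeff_X_pow, coeff_C]

/-- **The `X`-coefficient of the prediction vanishes on a `(-1)`-stable parameter.**  For `α` of
cardinality `2` with `{-x : x ∈ α} = α`, the `X`-coefficient of
`arithFrobPolyOfSatake ι q 2 α = ∏_{x ∈ α} (X - ι⁻¹((√q x)⁻¹))` is `-Σ_{x ∈ α} ι⁻¹((√q x)⁻¹)`,
an odd function of `α`, hence `0`. [folklore] -/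
theorem coeff_one_arithFrobPolyOfSatake_eq_zero (ι : PadicAlgCl 2 ≃+* ℂ) (q : ℕ) {α : Multiset ℂ}
    (hcard : Multiset.card α = 2) (hfix : α.map ((-1 : ℂ) * ·) = α) :
    (arithFrobPolyOfSatake ι q 2 α).coeff 1 = 0 := by
  set f : ℂ → PadicAlgCl 2 := fun a => ι.symm (((Real.sqrt q : ℝ) : ℂ) ^ (2 - 1) * a)⁻¹ with hf
  have hA : arithFrobPolyOfSatake ι q 2 α = ((α.map f).map fun x => X - C x).prod := by
    rw [arithFrobPolyOfSatake, Multiset.map_map]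
    rfl
  have hcoeff : (arithFrobPolyOfSatake ι q 2 α).coeff 1 = -(α.map f).sum := by
    have h := multiset_prod_X_sub_C_coeff_card_pred (α.map f)
      (by rw [Multiset.card_map, hcard]; norm_num)
    rw [Multiset.card_map, hcard] at h
    rw [hA]
    exact h
  have hodd : ∀ a, f ((-1 : ℂ) * a) = -f a := by
    intro a
    simp only [hf, neg_one_mul, mul_neg, inv_neg, map_neg]
  have hsum : (α.map f).sum = -(α.map f).sum := by
    conv_lhs => rw [← hfix, Multiset.map_map]
    simp only [Function.comp_def, hodd, Multiset.sum_map_neg]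
  have h0 : (α.map f).sum = 0 := by
    have h2 : (2 : PadicAlgCl 2) * (α.map f).sum = 0 := by linear_combination hsum
    exact (mul_eq_zero.mp h2).resolve_left two_ne_zero
  rw [hcoeff, h0, neg_zero]

/-! ### Places -/

/-- Only finitely many places of `ℚ` lie over a prime of the finite set of primes `S`
(`v ↦ p_v` is injective, `Rat.natGenerator_injective`). [folklore] -/
theorem finite_setOf_exists_natCast_mem (S : Finset ℕ) (hS : ∀ ℓ ∈ S, ℓ.Prime) :
    {v : HeightOneSpectrum (𝓞 ℚ) | ∃ ℓ ∈ S, ((ℓ : ℕ) : 𝓞 ℚ) ∈ v.asIdeal}.Finite := by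
  refine ((S.finite_toSet.preimage Rat.natGenerator_injective.injOn)).subset ?_
  rintro v ⟨ℓ, hℓ, hmem⟩
  rw [Rat.natCast_mem_asIdeal_iff] at hmem
  have h : Rat.HeightOneSpectrum.natGenerator v = ℓ :=
    (Nat.prime_dvd_prime_iff_eq (Rat.HeightOneSpectrum.prime_natGenerator v) (hS ℓ hℓ)).mp hmem
  show Rat.HeightOneSpectrum.natGenerator v ∈ (S : Set ℕ)
  rw [h]
  exact hℓ

/-- **An inert place has a place of residue degree `2` above it**: if `quadraticSign K v = -1`
(no place of `K` over `v` has residue degree `1`) and `[K:ℚ] = 2`, then some (any) place `w ∣ v` of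
`K` has `f(w|v) = 2` (`inertiaDeg_eq_one_or_two_of_finrank_eq_two`). [folklore] -/
theorem exists_place_inertiaDeg_eq_two {K : Type} [Field K] [NumberField K]
    (hK : Module.finrank ℚ K = 2) {v : HeightOneSpectrum (𝓞 ℚ)} (hε : quadraticSign K v = -1) :
    ∃ w : HeightOneSpectrum (𝓞 K), w.asIdeal.under (𝓞 ℚ) = v.asIdeal ∧
      w.asIdeal.inertiaDeg (𝓞 ℚ) = 2 := by
  obtain ⟨w, hw⟩ := exists_above (E := K) v
  refine ⟨w, hw, ?_⟩
  rcases inertiaDeg_eq_one_or_two_of_finrank_eq_two hK v w hw with h1 | h2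
  · exfalso
    unfold quadraticSign at hε
    rw [if_pos ⟨w, hw, h1⟩] at hε
    norm_num at hε
  · exact h2

/-! ### The stub -/

open Summit.Langlands.Langlands.Theorems.ResidualBianchiDoorMod2 in
/-- **Stub `stub_cuspWitness` (a uniform-in-`K` non-twist witness at an inert good place).**  Let
`σ₀ : Γ_ℚ → GL₂(ℚ̄₂)` have finite image and projective image `≅ A₅`, `S` a finite set of primes, `π`
a cuspidal datum on `GL₂(𝔸_ℚ)` congruent to `σ₀` at every place outside `S`, and `K` a quadratic
field.  Then some place `v ∉ S` of `ℚ` is inert in `K` (a place `w ∣ v` of residue degree `2`) and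
`π` has there a Satake parameter `α` with `-α ≠ α`.  Proof: an element of order `3` of `A₅` lifts to
`g₀ ∉ Γ_K` (`Γ_K ↠ A₅` by `projectiveImage_comp_eq_of_index_two`); Cayley–Hamilton: `M³` scalar,
`M` non-scalar ⇒ `tr² = det`, a root of unity; Chebotarev with the quadratic sign
(`infinite_setOf_frob_eq_and_quadraticSign_eq_neg_one`, `chebotarev_artinRep_holds`, applied to
`GL₂(ι) ∘ σ₀`) gives infinitely many inert `v` with `σ₀(Frob_v) = σ₀(g₀)`, one of them over no
prime of `S`; there `‖a + b‖ = 1`, so the `X`-coefficient of `arithFrobPolyOfSatake ι q 2 α` is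
non-zero, which fails for `α = -α`. [folklore] -/
theorem stub_cuspWitness (ι : PadicAlgCl 2 ≃+* ℂ) (σ₀ : FramedGaloisRep ℚ (PadicAlgCl 2) 2)
    (hfin : Finite σ₀.toMonoidHom.range)
    (hA5 : Nonempty (projectiveImage σ₀.toMonoidHom ≃* alternatingGroup (Fin 5)))
    (S : Finset ℕ) (hS : ∀ ℓ ∈ S, ℓ.Prime) (hcptQ : isCompact_glFiniteIntegralLevel 2 ℚ)
    (πQ : CuspidalAutomorphicRepData 2 ℚ hcptQ)
    (hgood : ∀ v : HeightOneSpectrum (𝓞 ℚ), (∀ ℓ ∈ S, ((ℓ : ℕ) : 𝓞 ℚ) ∉ v.asIdeal) →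
      ∃ (α : Multiset ℂ) (a b : PadicAlgCl 2), ‖a‖ ≤ 1 ∧ ‖b‖ ≤ 1 ∧
        πQ.1.HasSatakeParamAt v α ∧ σ₀.IsUnramifiedAt v ∧
        σ₀.HasFrobCharpolyAt v ((X - C a) * (X - C b)) ∧
        ∀ i : ℕ, ‖((X - C a) * (X - C b)).coeff i -
          (arithFrobPolyOfSatake ι v.residueCard 2 α).coeff i‖ < 1)
    (K : Type) [Field K] [NumberField K] (hK : Module.finrank ℚ K = 2) :
    ∃ (v : HeightOneSpectrum (𝓞 ℚ)) (w : HeightOneSpectrum (𝓞 K)) (α : Multiset ℂ),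
      w.asIdeal.under (𝓞 ℚ) = v.asIdeal ∧ w.asIdeal.inertiaDeg (𝓞 ℚ) = Module.finrank ℚ K ∧
      πQ.1.HasSatakeParamAt v α ∧
      ∀ ζ : ℂ, IsPrimitiveRoot ζ (Module.finrank ℚ K) → α.map (ζ * ·) ≠ α := by
  classical
  obtain ⟨e⟩ := hA5
  haveI : FiniteDimensional ℚ K := Module.finite_of_finrank_eq_succ hK
  -- (1) an element `g₀ ∉ Γ_K` of projective order `3`
  have hidx : ((absGaloisRestrict ℚ K).range : Subgroup (Field.absoluteGaloisGroup ℚ)).index = 2 :=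
    hK ▸ (isOpen_range_absGaloisRestrict_and_index ℚ K).2
  obtain ⟨x, hx1, hx3⟩ := exists_alternatingGroup_fin_five_ne_one_and_pow_three_eq_one
  obtain ⟨y, hy1, hy3⟩ : ∃ y : projectiveImage σ₀.toMonoidHom, y ≠ 1 ∧ y ^ 3 = 1 :=
    ⟨e.symm x, fun h => hx1 (e.symm.injective (h.trans (map_one e.symm).symm)),
      by rw [← map_pow, hx3, map_one]⟩
  obtain ⟨g', hg'⟩ : ∃ g' : Field.absoluteGaloisGroup ℚ,
      g' ∉ ((absGaloisRestrict ℚ K).range : Subgroup (Field.absoluteGaloisGroup ℚ)) := by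
    by_contra! h
    rw [(Subgroup.eq_top_iff' _).mpr h, Subgroup.index_top] at hidx
    exact absurd hidx (by norm_num)
  have hPI : projectiveImage (σ₀.toMonoidHom.comp (absGaloisRestrict ℚ K).toMonoidHom) =
      projectiveImage σ₀.toMonoidHom :=
    projectiveImage_comp_eq_of_index_two _ _ hidx (isSimpleGroup_of_mulEquiv_alternatingGroup e)
      (card_ne_two_of_mulEquiv_alternatingGroup e)
  have hz : (Matrix.ProjGenLinGroup.mk (σ₀ g'))⁻¹ * (y : PGL(Fin 2, PadicAlgCl 2)) ∈
      projectiveImage (σ₀.toMonoidHom.comp (absGaloisRestrict ℚ K).toMonoidHom) := by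
    rw [hPI]
    exact Subgroup.mul_mem _ (Subgroup.inv_mem _ ⟨g', rfl⟩) y.2
  obtain ⟨h, hh⟩ := hz
  have hh' : Matrix.ProjGenLinGroup.mk (σ₀ (absGaloisRestrict ℚ K h)) =
      (Matrix.ProjGenLinGroup.mk (σ₀ g'))⁻¹ * (y : PGL(Fin 2, PadicAlgCl 2)) := hh
  set g₀ : Field.absoluteGaloisGroup ℚ := g' * absGaloisRestrict ℚ K h with hg₀def
  have hg₀ : g₀ ∉ ((absGaloisRestrict ℚ K).range : Subgroup (Field.absoluteGaloisGroup ℚ)) := by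
    intro hmem
    apply hg'
    have hg'eq : g' = g₀ * (absGaloisRestrict ℚ K h)⁻¹ := by rw [hg₀def, mul_inv_cancel_right]
    rw [hg'eq]
    exact Subgroup.mul_mem _ hmem (Subgroup.inv_mem _ ⟨h, rfl⟩)
  have hproj : Matrix.ProjGenLinGroup.mk (σ₀ g₀) = y := by
    rw [hg₀def, map_mul, map_mul, hh', mul_inv_cancel_left]
  -- (2) `M := σ₀ g₀`: `M³` scalar, `M` non-scalar, of finite order ⇒ `‖tr M‖ = 1`
  set M : Matrix (Fin 2) (Fin 2) (PadicAlgCl 2) :=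
    ((σ₀ g₀ : GL (Fin 2) (PadicAlgCl 2)) : Matrix (Fin 2) (Fin 2) (PadicAlgCl 2)) with hMdef
  have hM3 : M ^ 3 ∈ Set.range (Matrix.scalar (Fin 2)) := by
    have h3 : Matrix.ProjGenLinGroup.mk (σ₀ g₀ ^ 3) = 1 := by
      rw [map_pow, hproj, ← Subgroup.coe_pow, hy3, Subgroup.coe_one]
    rw [Matrix.ProjGenLinGroup.mk_eq_one,
      Matrix.GeneralLinearGroup.mem_center_iff_val_mem_range_scalar, Units.val_pow_eq_pow_val] at h3
    exact h3
  have hM1 : M ∉ Set.range (Matrix.scalar (Fin 2)) := by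
    intro h1
    apply hy1
    rw [← Subtype.coe_inj, ← hproj, Subgroup.coe_one, Matrix.ProjGenLinGroup.mk_eq_one,
      Matrix.GeneralLinearGroup.mem_center_iff_val_mem_range_scalar]
    exact h1
  obtain ⟨N, hN, hMN⟩ : ∃ N : ℕ, 0 < N ∧ M ^ N = 1 := by
    haveI := hfin
    have hfo : IsOfFinOrder (⟨σ₀ g₀, g₀, rfl⟩ : σ₀.toMonoidHom.range) := isOfFinOrder_of_finite _
    obtain ⟨N, hN, h1⟩ := hfo.exists_pow_eq_one
    refine ⟨N, hN, ?_⟩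
    have h2 : (σ₀ g₀ : GL (Fin 2) (PadicAlgCl 2)) ^ N = 1 := congrArg Subtype.val h1
    rw [hMdef, ← Units.val_pow_eq_pow_val, h2, Units.val_one]
  have htr : ‖M.trace‖ = 1 := norm_trace_eq_one_of_pow_three hM3 hM1 hN hMN
  -- (3) Chebotarev over `ℂ`, transported along `ι`
  haveI := hfin
  obtain ⟨σC, hσC, -, -⟩ := exists_map_ringEquiv σ₀ ι
  have hσCapp : ∀ g, σC g = Matrix.GeneralLinearGroup.map ι.toRingHom (σ₀ g) := fun g => by
    change σC.toMonoidHom g = _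
    rw [hσC]
    rfl
  have hinf := infinite_setOf_frob_eq_and_quadraticSign_eq_neg_one K chebotarev_artinRep_holds
    σC hK hg₀
  -- (4) a good such place
  obtain ⟨v, ⟨-, hε, 𝔓, h𝔓, φ, hφ, hφg⟩, hvB⟩ :=
    (hinf.sdiff (finite_setOf_exists_natCast_mem S hS)).nonempty
  have hv : ∀ ℓ ∈ S, ((ℓ : ℕ) : 𝓞 ℚ) ∉ v.asIdeal := fun ℓ hℓ hmem => hvB ⟨ℓ, hℓ, hmem⟩
  obtain ⟨α, a, b, -, -, hsat, -, hchar, hcongr⟩ := hgood v hv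
  -- (5) `tr M = a + b` (Mathlib `Matrix.trace_eq_neg_charpoly_nextCoeff`)
  have hφg' : σ₀ φ = σ₀ g₀ := by
    rw [hσCapp, hσCapp] at hφg
    exact generalLinearGroup_map_ringEquiv_injective ι hφg
  have hab : M.trace = a + b := by
    have hc : M.charpoly = (X - C a) * (X - C b) := by
      have h := hchar 𝔓 h𝔓 φ hφ
      unfold FramedRep.charpoly at h
      rw [hφg'] at h
      exact h
    rw [Matrix.trace_eq_neg_charpoly_nextCoeff, hc,
      Polynomial.Monic.nextCoeff_mul (monic_X_sub_C a) (monic_X_sub_C b), nextCoeff_X_sub_C,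
      nextCoeff_X_sub_C]
    ring
  -- (6) the inert place and the non-twist
  obtain ⟨w, hw, hfw⟩ := exists_place_inertiaDeg_eq_two hK hε
  refine ⟨v, w, α, hw, hfw.trans hK.symm, hsat, ?_⟩
  intro ζ hζ heq
  rw [hK] at hζ
  obtain rfl : ζ = -1 := hζ.eq_neg_one_of_two_right
  have h0 := coeff_one_arithFrobPolyOfSatake_eq_zero ι v.residueCard hsat.card_eq heq
  have h1 := hcongr 1
  rw [h0, sub_zero, coeff_one_X_sub_C_mul, norm_neg, ← hab, htr] at h1
  exact lt_irrefl _ h1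

end Summit.Langlands.Langlands.Cruxes.ResidualBianchiDoorLevel.Sketch

end
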